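import Mathlib
import Summits.ValiantsHypothesis.ValiantsHypothesis.Theorems.LiouvilleSarnakLiouvilleCutRankOneScaleTransfer
import Summits.ValiantsHypothesis.ValiantsHypothesis.Theorems.LiouvilleSarnakDigitalBilinearLiouvilleTtStarCutRank

/-!
# Route LiouvilleSarnak — crux `LiouvilleCutRank` (stmt-ValiantsHypothesis-14775):
# the RELAXED-MODEL bridge — a purely combinatorial sufficient condition for the crux

Fix a finite set `D` of multipliers.  The RELAXED MODEL at level `n` consists of all sign functions
`g : [1, 4^n] → {±1}` with `g(d m) = λ(d) g(m)` for `d ∈ D`, `d m ≤ 4^n` — partial complete multiplicativity at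
the multipliers `D` only (`λ` itself is one of them, for every `D`).  Hypothesis `S_D`: for every `W` there is a
level `n` at which EVERY relaxed `g` has at least `2^W` distinct rows on EVERY cut `π` of the `2n` bit positions
(rows `r ↦ (c ↦ g(N_π(r,c) + 1))`).  Then

* ★ `liouvilleCutRank_of_relaxedModel` — `S_D ⟹ LiouvilleCutRank` (through `λ ∈` model, "`±1` matrix with
  `2^W` distinct rows has rank `≥ W`" = `TtStarCutRank.card_image_rows_le_two_pow_rank`, and the one-scale
  transfer `OneScale.liouvilleCutRank_of_rankAtOneScale` = line `one_scale` stubs 1–2);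
* `le_rank_of_relaxedModel_level` — the one-level form (a relaxed bound at level `n` bounds every cut at level
  `n`, and then at every level `≥ n²`); `liouvilleCutRank_of_relaxedModel'` — the plain-count form.

WHY THIS IS A ROUTE AND WHICH `D` (honest framing; data of this session, folder `numerics/`, kernel-independent):
`S_D` is a finite combinatorial statement per `(W, n)` (an `𝔽₂`-affine realisability question: the free data of a
relaxed `g` are its signs on the `D`-rough parts, and "rows `r, r'` equal" is affine; `…CycleCertificates`'s class
cycles are its exact obstructions).  EXACT minima of the number of distinct rows over the relaxed model, ALL `2^n`
rows, by branch and bound: with `D = {2,3,5,7}` — Thue–Morse cut words `13/16, 24/32, 44/64` (`2n = 8, 10, 12`);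
`(CR)^n` `12, 25, ≤ 45`; eight random balanced words at `2n = 10`: `15–24` of `32`; the ALIGNED cuts `C^5R^5`,
`R^5C^5`: `24, 23`; near-aligned `C^4R^5C`, `CR^5C^4`: `28, 28`.  With `D = {2,3}`: Thue–Morse `5, 7, 9`,
`(CR)^n` exactly `n + 1`, aligned `4` (bounded); with `D = {2,3,5}`: Thue–Morse `10` at `2n = 12`.  The small
budgets are PROVABLY dead: the `χ₄`-, `χ₈`-, `χ₄χ₈`-twins (`…MultiplicativeBarrier`, `…ModEightBarrier`) are
relaxed functions for every `D` whose odd members lie in `{m : χ(m) = λ(m)}` for one real character `χ` of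
conductor `∣ 8`, and they have `≤ 6` distinct aligned rows at every level — so `S_D` is FALSE for
`D ⊆ {2, 3, 7, 11, …}`, `D ⊆ {2, 3, 5, 11, 13, …}`, `D ⊆ {2, 5, 7, 13, …}`; the smallest initial segment not
excluded is `D = {2,3,5,7}`, where the data above show near-full forcing at `2n ≤ 12`.  Whether `S_{2,3,5,7}` holds
is OPEN (a problem on `7`-smooth ratios inside `[1,4^n]`, with no analytic number theory in it); for the bilinear
crux `DigitalBilinearLiouville` no finite `D` can work (`…DigitalBilinearLiouvilleFiniteBudgetBarrier`).
`LiouvilleCutRank`, `DigitalBilinearLiouville`, `AlgebraicSarnak` stay OPEN; nothing bears on `VP ≠ VNP`.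
No definitions.
-/

set_option linter.dupNamespace false

noncomputable section

namespace Summit.ValiantsHypothesis.ValiantsHypothesis.Theorems.LiouvilleSarnakLiouvilleCutRank.RelaxedModelBridge

open ArithmeticFunction Finset

open Summit.ValiantsHypothesis.ValiantsHypothesis.Theses.LiouvilleSarnak
open Summit.ValiantsHypothesis.ValiantsHypothesis.Theorems.LiouvilleSarnakLiouvilleCutRank.OneScale
  (liouvilleCutRank_of_rankAtOneScale le_rank_of_forall_level)
open Summit.ValiantsHypothesis.ValiantsHypothesis.Theorems.LiouvilleSarnakDigitalBilinearLiouville.TtStarCutRank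
  (card_image_rows_le_two_pow_rank)

/-- `λ` is a member of every relaxed model: `±1`-valued on positive integers … [folklore] -/
theorem liouville_eq_one_or_eq_neg_one (m : ℕ) (hm : 1 ≤ m) : liouville m = 1 ∨ liouville m = -1 := by
  rw [liouville_apply (by omega)]
  exact neg_one_pow_eq_or ℤ _

/-- … and `λ(d m) = λ(d) λ(m)` for every multiplier `d`. [folklore] -/
theorem liouville_mul_eq (d m : ℕ) : liouville (d * m) = liouville d * liouville m :=
  liouville_apply_mul d m

/-- **One level.**  If at level `n` every relaxed sign function (`±1` on `[1,4^n]`, `g(d m) = λ(d) g(m)` for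
`d ∈ D`, `d m ≤ 4^n`) has at least `2^W` distinct rows on every cut, then every Liouville cut matrix at every
level `N ≥ n²` has rank `≥ W` (`λ` is relaxed; distinct `±1` rows `≤ 2^{rank}`;
`OneScale.le_rank_of_forall_level`). [this file] -/
theorem le_rank_of_relaxedModel_level (D : Finset ℕ) (W n : ℕ)
    (h : ∀ g : ℕ → ℤ, (∀ m, 1 ≤ m → m ≤ 4 ^ n → g m = 1 ∨ g m = -1) →
      (∀ d ∈ D, ∀ m, 1 ≤ m → d * m ≤ 4 ^ n → g (d * m) = liouville d * g m) →
      ∀ π : Fin n ⊕ Fin n ≃ Fin (2 * n),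
        2 ^ W ≤ ((univ : Finset (Fin n → Bool)).image (fun r c : Fin n → Bool =>
          g (Nat.ofBits (fun j : Fin (2 * n) => Sum.elim r c (π.symm j)) + 1))).card) :
    ∀ N : ℕ, n * n ≤ N → ∀ π : Fin N ⊕ Fin N ≃ Fin (2 * N),
      W ≤ (Matrix.of fun r c : Fin N → Bool =>
        (((liouville (Nat.ofBits (fun j : Fin (2 * N) => Sum.elim r c (π.symm j)) + 1) : ℤ) : ℂ))).rank := by
  have hlevel : ∀ π₁ : Fin n ⊕ Fin n ≃ Fin (2 * n),
      W ≤ (Matrix.of fun r c : Fin n → Bool =>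
        (((liouville (Nat.ofBits (fun j : Fin (2 * n) => Sum.elim r c (π₁.symm j)) + 1) : ℤ) : ℂ))).rank := by
    intro π₁
    have h1 := h (fun m => liouville m) (fun m hm _ => liouville_eq_one_or_eq_neg_one m hm)
      (fun d _ m _ _ => liouville_mul_eq d m) π₁
    have h2 := card_image_rows_le_two_pow_rank n π₁
    exact (Nat.pow_le_pow_iff_right (by norm_num)).mp (h1.trans h2)
  intro N hN π
  exact le_rank_of_forall_level W n hlevel N hN π

/-- ★ **The relaxed-model bridge.**  Let `D` be any finite set of multipliers.  Suppose that for every `W`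
there is a level `n` such that EVERY sign function `g`, `±1`-valued on `[1, 4^n]` and satisfying
`g(d m) = λ(d) g(m)` for all `d ∈ D` with `d m ≤ 4^n`, has at least `2^W` distinct rows
`r ↦ (c ↦ g(N_π(r,c)+1))` on EVERY cut `π` of the `2n` bit positions.  Then `LiouvilleCutRank` holds.
(`λ` is such a `g`; `2^W` distinct `±1` rows force rank `≥ W`; one-scale transfer.) [this file] -/
theorem liouvilleCutRank_of_relaxedModel (D : Finset ℕ)
    (h : ∀ W : ℕ, ∃ n : ℕ, ∀ g : ℕ → ℤ, (∀ m, 1 ≤ m → m ≤ 4 ^ n → g m = 1 ∨ g m = -1) →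
      (∀ d ∈ D, ∀ m, 1 ≤ m → d * m ≤ 4 ^ n → g (d * m) = liouville d * g m) →
      ∀ π : Fin n ⊕ Fin n ≃ Fin (2 * n),
        2 ^ W ≤ ((univ : Finset (Fin n → Bool)).image (fun r c : Fin n → Bool =>
          g (Nat.ofBits (fun j : Fin (2 * n) => Sum.elim r c (π.symm j)) + 1))).card) :
    LiouvilleCutRank := by
  refine liouvilleCutRank_of_rankAtOneScale fun W => ?_
  obtain ⟨n, hn⟩ := h W
  refine ⟨n, fun π₁ => ?_⟩
  have h1 := hn (fun m => liouville m) (fun m hm _ => liouville_eq_one_or_eq_neg_one m hm)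
    (fun d _ m _ _ => liouville_mul_eq d m) π₁
  have h2 := card_image_rows_le_two_pow_rank n π₁
  exact (Nat.pow_le_pow_iff_right (by norm_num)).mp (h1.trans h2)

/-- **The distinct-rows form with a plain count.**  Same bridge with the relaxed conclusion stated as
"more than `K` distinct rows" for every `K` (take `K = 2^W - 1`). [this file] -/
theorem liouvilleCutRank_of_relaxedModel' (D : Finset ℕ)
    (h : ∀ K : ℕ, ∃ n : ℕ, ∀ g : ℕ → ℤ, (∀ m, 1 ≤ m → m ≤ 4 ^ n → g m = 1 ∨ g m = -1) →
      (∀ d ∈ D, ∀ m, 1 ≤ m → d * m ≤ 4 ^ n → g (d * m) = liouville d * g m) →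
      ∀ π : Fin n ⊕ Fin n ≃ Fin (2 * n),
        K < ((univ : Finset (Fin n → Bool)).image (fun r c : Fin n → Bool =>
          g (Nat.ofBits (fun j : Fin (2 * n) => Sum.elim r c (π.symm j)) + 1))).card) :
    LiouvilleCutRank := by
  refine liouvilleCutRank_of_relaxedModel D fun W => ?_
  obtain ⟨n, hn⟩ := h (2 ^ W - 1)
  refine ⟨n, fun g hg1 hg2 π => ?_⟩
  have := hn g hg1 hg2 π
  omega

end Summit.ValiantsHypothesis.ValiantsHypothesis.Theorems.LiouvilleSarnakLiouvilleCutRank.RelaxedModelBridge
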